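import Mathlib
import Summits.KontsevichZagierPeriods.Zeta5Search.BrickPhiTaylor

/-!
# BrickPhiCube — `Φ_{n,p}(−j+T) ≡ 1 + p³·U(T)/(p−1)! (mod p⁶)` with `U ∈ ℤ[T]`: the `p³`-part of the
Frobenius factor of the brick kernel is a `p`-INTEGRAL POLYNOMIAL in the digit index (cell zeta5-irr)

HONEST FRAMING: systematic search; no irrationality claim unless certified. INSTRUMENT lemma of the ζ(5)
census cell zeta5-irr (HOME `run/shared/lean/pub/zeta5-irr/`; zi-p2's THEOREM 7 blueprint
`zi-p2/probes/B8/thm7-plan/PLAN-T7.md` LEMMA L7.3 «u := (Φ_{n,p}(−j) − 1)/p³ IS A p-INTEGRAL POLYNOMIAL IN j MOD p³»,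
whose sketch rests on «Q(y)/(p−1)! = ∏_r(1 + py/r) = 1 + p³g(y), g ∈ ℤ_(p)[y]»). Nothing here is about ζ(5); no
irrationality content; filing moves no rung. Filed by the engine seat zi-eng (g7); sequel of `BrickPhiTaylor`.

## The statement

`p ≥ 5` prime, `2B ≤ A`, `n ∈ ℕ`, `j ∈ ℤ`; `N = phiNum A B p n j`, `D = phiDen A p n j ∈ ℤ[T]` are the numerator and
denominator of `Φ_{n,p}(−j+T)` (`BrickPhiTaylor.brickPhi_neg_add_eq`). The EXACT polynomial block law (Glaisher;
tree `Ljunggren.block_congruence` at `q = T`): `F_p(pT) := ∏_{0<r<p}(pT + r) = (p−1)! + p³·G_p(T)` for some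
`G_p ∈ ℤ[T]` (`exists_blockPoly`; `G_p/(p−1)!` is zi-p2's `g`), hence `∏_{0<r<p}(p·q + r) = (p−1)! + p³·G_p(q)` for every
`q ∈ ℤ[T]` (`block_comp`). Grouping the four products of `N`, `D` into complete residue blocks with linear arguments
`q_b = c + b ± T` (as in `BrickPhiTaylor`) and using `(p³)² ≡ 0 (mod p⁶)`:

**`(p−1)!·N(T) ≡ D(T)·((p−1)! + p³·U(T)) (mod p⁶ℤ[T])`**, with the EXPLICIT integer polynomial
`U = (A−2B)·Σ_{b<n}G_p(b) + B·Σ_{b<n}G_p(j+b−T) + B·Σ_{b<n}G_p(n−j+b+T) − A·Σ_{b<n}G_p(b−j+T)` (`phiCubeU`).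
Since `(p−1)!` and `D(s) = (∏_{p∤ℓ}(ℓ − (j−s)p))^A` (`s ∈ ℤ`) are `p`-units: `u(j−s) ≡ U(s)/(p−1)! (mod p³)` for every
`s ∈ ℤ` — `u` is a polynomial in the digit index with coefficients in `(1/(p−1)!)ℤ ⊂ ℤ_(p)` (L7.3), hence
`u(j + p^k) ≡ u(j) (mod p^k)` for `k ≤ 3`. (Modulo `p⁴`, `p⁵`: `BrickPhiTaylor` gives the explicit quadratic.)

PROVED here (everything; standard axioms): `exists_blockPoly`, `block_comp`, defs `blockSumX`, `phiCubeU`,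
**`C_pow_six_dvd_phiNum_sub`** (the congruence above, for any `G` with `F_p(pT) = (p−1)! + p³G`),
`not_dvd_phiDen_eval` (`D(s)` is a `p`-unit for every `s ∈ ℤ`).
-/

namespace Summit.KontsevichZagierPeriods.Zeta5Search.BrickPhiCube

open Finset Nat Polynomial
open Summit.KontsevichZagierPeriods.Zeta5Search.FrobeniusFactorisation (prod_filter_not_dvd_eq_prod_prod
  not_dvd_prod_filter_sub_mul)
open Summit.KontsevichZagierPeriods.Zeta5Search.BrickPhiTaylor (phiNum phiDen)
open Literature.NumberTheory.Congruences

noncomputable section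

variable {p : ℕ}

/-! ## The exact polynomial block law `F_p(pT) = (p−1)! + p³·G_p(T)` -/

/-- **The block polynomial has an integral `p³`-correction**: for a prime `p ≥ 5` there is `G_p ∈ ℤ[T]` with
`∏_{0<r<p}(pT + r) = (p−1)! + p³·G_p(T)` (tree `Ljunggren.block_congruence` at `q = T`; Wolstenholme's theorem is
the content: the coefficients `p·A_{p−2}`, `p²·A_{p−3}` of `T`, `T²` are divisible by `p³`). -/
theorem exists_blockPoly (hp : p.Prime) (h3 : 3 < p) :
    ∃ G : ℤ[X], ∏ i ∈ Icc 1 (p - 1), (C (p : ℤ) * X + C (i : ℤ)) = C (((p - 1)! : ℕ) : ℤ) + C ((p : ℤ) ^ 3) * G := by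
  obtain ⟨G, hG⟩ := Ljunggren.block_congruence hp h3 X
  simp only [Polynomial.prod_comp, add_comp, X_comp, C_comp] at hG
  exact ⟨G, by linear_combination hG⟩

/-- The block law at every polynomial argument: `∏_{0<r<p}(p·q + r) = (p−1)! + p³·G_p(q)`, `q ∈ ℤ[T]`. -/
theorem block_comp {G : ℤ[X]}
    (hG : ∏ i ∈ Icc 1 (p - 1), (C (p : ℤ) * X + C (i : ℤ)) = C (((p - 1)! : ℕ) : ℤ) + C ((p : ℤ) ^ 3) * G)
    (q : ℤ[X]) :
    ∏ i ∈ Icc 1 (p - 1), (C (p : ℤ) * q + C (i : ℤ)) = C (((p - 1)! : ℕ) : ℤ) + C ((p : ℤ) ^ 3) * G.comp q := by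
  have h := congrArg (fun f : ℤ[X] => f.comp q) hG
  simp only [Polynomial.prod_comp, mul_comp, add_comp, X_comp, C_comp] at h
  exact h

/-- The block sum `Σ_{b<n} G(c + b) ∈ ℤ[T]` of a polynomial `G` over `n` consecutive blocks starting at `c ∈ ℤ[T]`. -/
def blockSumX (n : ℕ) (G c : ℤ[X]) : ℤ[X] := ∑ b ∈ range n, G.comp (c + C (b : ℤ))

/-- The `p³`-part of `Φ_{n,p}(−j+T)` relative to `G`:
`U = (A−2B)·Σ_b G(b) + B·Σ_b G(j+b−T) + B·Σ_b G(n−j+b+T) − A·Σ_b G(b−j+T)` (blocks of `W`, `∏(jp+ℓ−pT)`,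
`∏((n−j)p+ℓ+pT)` counted `+`, blocks of the denominator counted `−`, with multiplicity). -/
def phiCubeU (A B n : ℕ) (j : ℤ) (G : ℤ[X]) : ℤ[X] :=
  C (((A - 2 * B : ℕ) : ℤ)) * blockSumX n G 0 + C (B : ℤ) * blockSumX n G (C j - X) +
    C (B : ℤ) * blockSumX n G (C ((n : ℤ) - j) + X) - C (A : ℤ) * blockSumX n G (X - C j)

/-! ## Nilpotent bookkeeping (as in `BrickPhiFour`/`BrickPhiTaylor`) -/

section nilpotent

variable {R : Type*} [CommRing R] {μ : R}

/-- `∏_{b<n}(1 + x_b μ) = 1 + (Σ_{b<n} x_b)·μ` when `μ² = 0`. [folklore] -/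
private theorem prod_one_add_mul (hμ : μ * μ = 0) (x : ℕ → R) (n : ℕ) :
    ∏ b ∈ range n, (1 + x b * μ) = 1 + (∑ b ∈ range n, x b) * μ := by
  induction n with
  | zero => simp
  | succ n ih =>
    rw [Finset.prod_range_succ, ih, Finset.sum_range_succ]
    linear_combination ((∑ b ∈ range n, x b) * x n) * hμ

/-- `(1 + x μ)^k = 1 + k·x·μ` when `μ² = 0`. [folklore] -/
private theorem one_add_mul_pow (hμ : μ * μ = 0) (x : R) (k : ℕ) :
    (1 + x * μ) ^ k = 1 + (k : R) * x * μ := by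
  have h := prod_one_add_mul hμ (fun _ => x) k
  rw [Finset.prod_const, Finset.card_range, Finset.sum_const, Finset.card_range, nsmul_eq_mul] at h
  rw [h]

/-- The assembly identity (any commutative ring): with `L² = 0`, `uF = 1`,
`F·[Fⁿᵃ(1 + a m₀ Lu)]·[FⁿB(1 + B m₁ Lu)]·[FⁿB(1 + B m₂ Lu)] = Fⁿ⁽ᵃ⁺²ᴮ⁾(1 + (a+2B) m₃ Lu)·(F + L·q)`,
`q = a m₀ + B m₁ + B m₂ − (a+2B) m₃`. [folklore] -/
private theorem assembly {F L u m₀ m₁ m₂ m₃ : R} (hL : L * L = 0) (hu : u * F = 1) (n a B : ℕ) :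
    F * ((F ^ n) ^ a * (1 + (a : R) * m₀ * (L * u))) * ((F ^ n) ^ B * (1 + (B : R) * m₁ * (L * u))) *
        ((F ^ n) ^ B * (1 + (B : R) * m₂ * (L * u))) =
      (F ^ n) ^ (a + 2 * B) * (1 + ((a : R) + 2 * (B : R)) * m₃ * (L * u)) *
        (F + L * ((a : R) * m₀ + B * m₁ + B * m₂ - ((a : R) + 2 * (B : R)) * m₃)) := by
  rw [show (F ^ n) ^ (a + 2 * B) = (F ^ n) ^ a * (F ^ n) ^ B * (F ^ n) ^ B by ring]
  set P : R := (F ^ n) ^ a * (F ^ n) ^ B * (F ^ n) ^ B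
  set α : R := (a : R) * m₀
  set β : R := (B : R) * m₁
  set γ : R := (B : R) * m₂
  set δ : R := ((a : R) + 2 * (B : R)) * m₃
  linear_combination (P * L * (α + β + γ - δ)) * hu +
    (P * (-(δ * (α + β + γ - δ) * u) + F * (α * β + α * γ + β * γ) * u ^ 2 + F * α * β * γ * L * u ^ 3)) * hL

end nilpotent

/-! ## The congruence modulo `p⁶ℤ[T]` -/

/-- `(p−1)!` is a unit modulo `p⁶`. -/
private theorem exists_inv_factorial (hp : p.Prime) :
    ∃ u : ZMod (p ^ 6), u * (((p - 1)! : ℕ) : ZMod (p ^ 6)) = 1 := by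
  have hc : Nat.Coprime (p - 1)! (p ^ 6) := by
    refine Nat.Coprime.pow_right 6 (Nat.coprime_comm.1 ((Nat.Prime.coprime_iff_not_dvd hp).2 ?_))
    rw [hp.dvd_factorial]
    have := hp.one_lt
    omega
  exact ⟨(((ZMod.unitOfCoprime _ hc)⁻¹ : (ZMod (p ^ 6))ˣ) : ZMod (p ^ 6)),
    by rw [← ZMod.coe_unitOfCoprime _ hc, Units.inv_mul]⟩

/-- `f ↦ 0` in `(ℤ/m)[T]` implies `C m ∣ f` in `ℤ[T]`. [folklore] -/
private theorem C_dvd_of_map_eq_zero {m : ℕ} (f : ℤ[X]) (h : f.map (Int.castRingHom (ZMod m)) = 0) :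
    C (m : ℤ) ∣ f := by
  refine (C_dvd_iff_dvd_coeff _ _).2 fun i => (ZMod.intCast_zmod_eq_zero_iff_dvd _ _).1 ?_
  simpa only [coeff_map, eq_intCast, coeff_zero] using congrArg (fun g : (ZMod m)[X] => g.coeff i) h

/-- One block in `(ℤ/p⁶)[T]`: `∏_{0<r<p}(p·q + r) ↦ (p−1)!·(1 + G(q)·p³·u)`, `u = ((p−1)!)⁻¹`. -/
private theorem block_map_eq {G : ℤ[X]}
    (hG : ∏ i ∈ Icc 1 (p - 1), (C (p : ℤ) * X + C (i : ℤ)) = C (((p - 1)! : ℕ) : ℤ) + C ((p : ℤ) ^ 3) * G)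
    {u : ZMod (p ^ 6)} (hu : C u * (((p - 1)! : ℕ) : (ZMod (p ^ 6))[X]) = 1) (q : ℤ[X]) :
    (∏ i ∈ Icc 1 (p - 1), (C (p : ℤ) * q + C (i : ℤ))).map (Int.castRingHom (ZMod (p ^ 6))) =
      (((p - 1)! : ℕ) : (ZMod (p ^ 6))[X]) *
        (1 + (G.comp q).map (Int.castRingHom (ZMod (p ^ 6))) * ((p : (ZMod (p ^ 6))[X]) ^ 3 * C u)) := by
  have h := congrArg (Polynomial.map (Int.castRingHom (ZMod (p ^ 6)))) (block_comp hG q)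
  rw [h]
  simp only [Polynomial.map_add, Polynomial.map_mul, Polynomial.map_C]
  simp only [map_natCast, map_pow]
  linear_combination (-(G.comp q).map (Int.castRingHom (ZMod (p ^ 6))) * (p : (ZMod (p ^ 6))[X]) ^ 3) * hu

/-- The four products of `Φ_{n,p}(−j+T)` as blocks in `(ℤ/p⁶)[T]`:
`∏_{1≤ℓ≤np, p∤ℓ}(p·c + ℓ) ↦ ((p−1)!)ⁿ·(1 + Σ_{b<n}G(c+b)·p³·u)` for every `c ∈ ℤ[T]`. -/
private theorem prod_filter_map_eq (hp : p.Prime) {G : ℤ[X]}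
    (hG : ∏ i ∈ Icc 1 (p - 1), (C (p : ℤ) * X + C (i : ℤ)) = C (((p - 1)! : ℕ) : ℤ) + C ((p : ℤ) ^ 3) * G)
    {u : ZMod (p ^ 6)} (hu : C u * (((p - 1)! : ℕ) : (ZMod (p ^ 6))[X]) = 1)
    (hμ : ((p : (ZMod (p ^ 6))[X]) ^ 3 * C u) * ((p : (ZMod (p ^ 6))[X]) ^ 3 * C u) = 0) (n : ℕ) (c : ℤ[X]) :
    (∏ m ∈ (Icc 1 (n * p)).filter (fun m => ¬ p ∣ m), (C (p : ℤ) * c + C (m : ℤ))).map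
        (Int.castRingHom (ZMod (p ^ 6))) =
      (((p - 1)! : ℕ) : (ZMod (p ^ 6))[X]) ^ n *
        (1 + (blockSumX n G c).map (Int.castRingHom (ZMod (p ^ 6))) * ((p : (ZMod (p ^ 6))[X]) ^ 3 * C u)) := by
  rw [prod_filter_not_dvd_eq_prod_prod hp.pos n (fun m => C (p : ℤ) * c + C (m : ℤ)), Polynomial.map_prod]
  have hb : ∀ b ∈ range n,
      (∏ r ∈ Icc 1 (p - 1), (C (p : ℤ) * c + C ((b * p + r : ℕ) : ℤ))).map (Int.castRingHom (ZMod (p ^ 6))) =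
        (((p - 1)! : ℕ) : (ZMod (p ^ 6))[X]) *
          (1 + (G.comp (c + C (b : ℤ))).map (Int.castRingHom (ZMod (p ^ 6))) *
            ((p : (ZMod (p ^ 6))[X]) ^ 3 * C u)) := by
    intro b _
    have e : ∏ r ∈ Icc 1 (p - 1), (C (p : ℤ) * c + C ((b * p + r : ℕ) : ℤ)) =
        ∏ r ∈ Icc 1 (p - 1), (C (p : ℤ) * (c + C (b : ℤ)) + C (r : ℤ)) :=
      Finset.prod_congr rfl fun r _ => by rw [Nat.cast_add, Nat.cast_mul, map_add, map_mul]; ring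
    rw [e]; exact block_map_eq hG hu (c + C (b : ℤ))
  rw [Finset.prod_congr rfl hb, Finset.prod_mul_distrib, Finset.prod_const, Finset.card_range,
    prod_one_add_mul hμ (fun b => (G.comp (c + C (b : ℤ))).map (Int.castRingHom (ZMod (p ^ 6)))) n,
    blockSumX, Polynomial.map_sum]

/-- **`Φ_{n,p}(−j+T) ≡ 1 + p³·U(T)/(p−1)! (mod p⁶)` — the `p³`-part is an integral polynomial** (zi-p2 THEOREM 7
blueprint, L7.3): for a prime `p ≥ 5`, `2B ≤ A`, every `n`, every `j ∈ ℤ`, and any `G ∈ ℤ[T]` with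
`∏_{0<r<p}(pT + r) = (p−1)! + p³G` (`exists_blockPoly`):
`C(p⁶) ∣ (p−1)!·N − D·((p−1)! + p³·U)` in `ℤ[T]`, `N = phiNum`, `D = phiDen`, `U = phiCubeU A B n j G ∈ ℤ[T]`. -/
theorem C_pow_six_dvd_phiNum_sub (hp : p.Prime) {G : ℤ[X]}
    (hG : ∏ i ∈ Icc 1 (p - 1), (C (p : ℤ) * X + C (i : ℤ)) = C (((p - 1)! : ℕ) : ℤ) + C ((p : ℤ) ^ 3) * G)
    {A B : ℕ} (hAB : 2 * B ≤ A) (n : ℕ) (j : ℤ) :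
    C ((p : ℤ) ^ 6) ∣
      C (((p - 1)! : ℕ) : ℤ) * phiNum A B p n j -
        phiDen A p n j * (C (((p - 1)! : ℕ) : ℤ) + C ((p : ℤ) ^ 3) * phiCubeU A B n j G) := by
  obtain ⟨a, rfl⟩ : ∃ a, A = a + 2 * B := ⟨A - 2 * B, by omega⟩
  obtain ⟨u, hu⟩ := exists_inv_factorial (p := p) hp
  have hu' : C u * (((p - 1)! : ℕ) : (ZMod (p ^ 6))[X]) = 1 := by
    simpa only [map_mul, map_one, map_natCast] using congrArg (Polynomial.C : ZMod (p ^ 6) → (ZMod (p ^ 6))[X]) hu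
  have hL : (p : (ZMod (p ^ 6))[X]) ^ 3 * (p : (ZMod (p ^ 6))[X]) ^ 3 = 0 := by
    have h := congrArg (Polynomial.C : ZMod (p ^ 6) → (ZMod (p ^ 6))[X]) (ZMod.natCast_self (p ^ 6))
    simp only [Nat.cast_pow, map_pow, map_natCast, map_zero] at h
    linear_combination h
  have hμ : ((p : (ZMod (p ^ 6))[X]) ^ 3 * C u) * ((p : (ZMod (p ^ 6))[X]) ^ 3 * C u) = 0 := by
    linear_combination (C u * C u) * hL
  rw [(Nat.cast_pow p 6).symm]
  refine C_dvd_of_map_eq_zero _ ?_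
  have eW : C (((∏ m ∈ (Icc 1 (n * p)).filter (fun m => ¬ p ∣ m), m : ℕ) : ℤ)) =
      ∏ m ∈ (Icc 1 (n * p)).filter (fun m => ¬ p ∣ m), (C (p : ℤ) * 0 + C (m : ℤ)) := by
    rw [Nat.cast_prod, map_prod]
    exact Finset.prod_congr rfl fun m _ => by ring
  have e1 : ∏ m ∈ (Icc 1 (n * p)).filter (fun m => ¬ p ∣ m), (C (j * p + (m : ℤ)) - C (p : ℤ) * X) =
      ∏ m ∈ (Icc 1 (n * p)).filter (fun m => ¬ p ∣ m), (C (p : ℤ) * (C j - X) + C (m : ℤ)) :=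
    Finset.prod_congr rfl fun m _ => by rw [map_add, map_mul]; ring
  have e2 : ∏ m ∈ (Icc 1 (n * p)).filter (fun m => ¬ p ∣ m), (C (((n : ℤ) - j) * p + (m : ℤ)) + C (p : ℤ) * X) =
      ∏ m ∈ (Icc 1 (n * p)).filter (fun m => ¬ p ∣ m), (C (p : ℤ) * (C ((n : ℤ) - j) + X) + C (m : ℤ)) :=
    Finset.prod_congr rfl fun m _ => by rw [map_add, map_mul]; ring
  have e3 : ∏ m ∈ (Icc 1 (n * p)).filter (fun m => ¬ p ∣ m), (C ((m : ℤ) - j * p) + C (p : ℤ) * X) =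
      ∏ m ∈ (Icc 1 (n * p)).filter (fun m => ¬ p ∣ m), (C (p : ℤ) * (X - C j) + C (m : ℤ)) :=
    Finset.prod_congr rfl fun m _ => by rw [map_sub, map_mul]; ring
  rw [phiNum, phiDen, eW, e1, e2, e3]
  simp only [Polynomial.map_sub, Polynomial.map_mul, Polynomial.map_pow, Polynomial.map_add, Polynomial.map_C,
    prod_filter_map_eq hp hG hu' hμ]
  simp only [phiCubeU, Polynomial.map_sub, Polynomial.map_mul, Polynomial.map_add, Polynomial.map_C]
  simp only [map_natCast, map_pow, Nat.add_sub_cancel, mul_pow]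
  simp only [one_add_mul_pow hμ]
  simp only [Nat.cast_add, Nat.cast_mul, Nat.cast_ofNat]
  linear_combination assembly
    (m₀ := (blockSumX n G 0).map (Int.castRingHom (ZMod (p ^ 6))))
    (m₁ := (blockSumX n G (C j - X)).map (Int.castRingHom (ZMod (p ^ 6))))
    (m₂ := (blockSumX n G (C ((n : ℤ) - j) + X)).map (Int.castRingHom (ZMod (p ^ 6))))
    (m₃ := (blockSumX n G (X - C j)).map (Int.castRingHom (ZMod (p ^ 6)))) hL hu' n a B

/-- The denominator is a `p`-unit at every INTEGER argument: `p ∤ D(s) = (∏_{p∤ℓ}(ℓ − (j−s)p))^A`, `s ∈ ℤ` (`p ≥ 5`) —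
so the congruence divides: `u(j−s) = (Φ_{n,p}(−j+s) − 1)/p³ ≡ U(s)/(p−1)! (mod p³)` for every `s ∈ ℤ`. -/
theorem not_dvd_phiDen_eval (hp : p.Prime) (h3 : 3 < p) (A n : ℕ) (j s : ℤ) :
    ¬ (p : ℤ) ∣ (phiDen A p n j).eval s := by
  have hprime : Prime (p : ℤ) := Nat.prime_iff_prime_int.1 hp
  rw [phiDen, eval_pow, eval_prod]
  simp only [eval_add, eval_mul, eval_C, eval_X]
  intro h
  have h' := hprime.dvd_of_dvd_pow h
  have e : ∏ m ∈ (Icc 1 (n * p)).filter (fun m => ¬ p ∣ m), ((m : ℤ) - j * p + (p : ℤ) * s) =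
      ∏ m ∈ (Icc 1 (n * p)).filter (fun m => ¬ p ∣ m), ((m : ℤ) - (j - s) * p) :=
    Finset.prod_congr rfl fun m _ => by ring
  rw [e] at h'
  exact not_dvd_prod_filter_sub_mul hp h3 n (j - s) h'

end

end Summit.KontsevichZagierPeriods.Zeta5Search.BrickPhiCube
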